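import Summits.BirchSwinnertonDyer.BirchSwinnertonDyer.Theorems.GenusKolyvaginAtTwoPowDvdShaCardAtTwoRTOrderFourAuxiliaryDeepAvoiding
import HarnessLib

/-!
# Route `GenusKolyvaginAtTwo`, crux L_T `PowDvdShaCardAtTwoRT` (stmt-BirchSwinnertonDyer-23242), LINE 18 stub L, bottom rung:
# THE AUXILIARY AVOIDING `B` ON THE TWIN SIDE `Wd ≅ E^{(d_K)}` (odd depth), incl. the canonical family

Width seat `bsd-line-gk2-p4` g18 (cell `bsd-f1-sign2`), `--supports 23242 --as helper`.  THEOREMS ONLY (no definition, no named fact,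
no `sorry`; standard axioms).  Sequel of `…RTOrderFourAuxiliaryDeepAvoiding`.  BSD is NOT proved by any of this; neither is the crux
nor stub L.

WHY.  Odd-depth rungs of stub L run on the twin `Wd ≅ E^{(d_K)}` (the LEAD's engine: «the odd-depth twin is the same statement for `Wd`»);
the hypotheses transfer from `E` at the Gross–Kolyvagin primes `ℓ ∤ d_K` of `(E, K)` (`…TwinGrossPrimes`, p701030's transfer block).
* **`exists_auxiliary_bottomRung_not_mem_twin`**, `exists_auxiliary_bottomRung_not_mem_twin_canonical`.
Closes nothing.  BSD is NOT proved by any of this.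

References: [McCallumLMS1991] §5 proof of Prop. 5.2; [GrossLMS1991] §3 (3.2)–(3.3); [MilneADT2006] Ch. I Thm. 4.10.
-/

set_option autoImplicit false
-- the Theorems namespace of this sub repeats the summit name by design (D-0017 nested layout)
set_option linter.dupNamespace false

noncomputable section

open scoped Classical

open CategoryTheory Field NumberField IsDedekindDomain Function
open _root_.WeierstrassCurve
open Literature.NumberTheory.EllipticCurves
open Literature.NumberTheory.GaloisRepresentations
open Literature.NumberTheory.GaloisCohomology
open Summit.BirchSwinnertonDyer.Rank1Residual.X11b.KummerPT
open Summit.BirchSwinnertonDyer.Rank1Residual.X11b.FiniteDuality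
open Summit.BirchSwinnertonDyer.Rank1Residual.X11b.Relaxation
open scoped ContRepresentation

namespace Summit.BirchSwinnertonDyer.BirchSwinnertonDyer.Theorems.GenusExact.DeepOwnPrime

open Summit.BirchSwinnertonDyer.BirchSwinnertonDyer.Theorems.GenusExact.RelaxedCount

/-! ## §1 The twin side -/

section Twin

open Summit.BirchSwinnertonDyer.BirchSwinnertonDyer.Theorems.GenusExact.TwinGrossPrimes

variable (W : WeierstrassCurve ℚ) [W.IsElliptic] [W.IsGloballyMinimal]
variable (Wd : WeierstrassCurve ℚ) [Wd.IsElliptic] [Wd.IsGloballyMinimal]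
variable (e : geomTorsion Wd ((2 ^ 2 : ℕ) : ℤ) → geomTorsion Wd ((2 ^ 2 : ℕ) : ℤ) → AlgebraicClosure ℚ)
  (hμ : ∀ S T, e S T ^ (2 ^ 2) = 1)
  (hadd₁ : ∀ S₁ S₂ T, e (S₁ + S₂) T = e S₁ T * e S₂ T)
  (hadd₂ : ∀ S T₁ T₂, e S (T₁ + T₂) = e S T₁ * e S T₂)
  (hgal : ∀ (σ : absoluteGaloisGroup ℚ) (S T : geomTorsion Wd ((2 ^ 2 : ℕ) : ℤ)), σ • e S T = e (σ • S) (σ • T))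
  (halt : ∀ T, e T T = 1) (hnondeg : ∀ T, (∀ S, e S T = 1) → T = 0)
  (inv : LocalInvariants ℚ (2 ^ 2))

include halt hnondeg in
/-- **Auxiliary + reciprocity avoiding `B`, twin side.**  For a globally minimal model `Wd` of `E^{(d_K)}` (`K` imaginary quadratic, `d_K`
odd), with the Gross–Kolyvagin data of `s ∪ t` stated for `E` at primes `ℓ ∤ d_K` and `#B < 2^{#s}`: `∃ y ∈ H¹_{𝓛,⊤ on s∪t}(ℚ, Wd[4])` with
`2•y ∉ B` and the vanishing of the `l′`-term for every admissible `Z`. [cite: McCallumLMS1991, §5 proof of Prop. 5.2] [cite: GrossLMS1991, §3 (3.2)–(3.3)] -/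
theorem exists_auxiliary_bottomRung_not_mem_twin {K : Type} [Field K] [NumberField K]
    (hK : IsImaginaryQuadratic K) (hodd : Odd (NumberField.discr K)) (hΔ : W.Δ < 0) (hρ2 : W.HasSurjectiveModNGaloisRep 2)
    {C : VariableChange ℚ} (hC : C • W.quadraticTwist ((NumberField.discr K : ℤ) : ℚ) = Wd)
    (s t : Finset (Place ℚ)) (hst : Disjoint s t)
    (hTK : ∀ u ∈ s ∪ t, ∃ (v : HeightOneSpectrum (𝓞 ℚ)) (ℓ : ℕ) (_ : Fact ℓ.Prime), u = Sum.inr v ∧ ℓ ≠ 2 ∧ (ℓ : 𝓞 ℚ) ∈ v.asIdeal ∧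
      ¬ ((ℓ : ℤ) ∣ NumberField.discr K) ∧ W.HasGoodReductionAtPrime ℓ ∧ FrobEqFrobInfty W K 2 ℓ ∧
      2 ≤ Zhang2014.kolyvaginIndex W 2 ℓ)
    (ht4 : ∀ (v : HeightOneSpectrum (𝓞 ℚ)) (ℓ : ℕ), ℓ.Prime → Sum.inr v ∈ t → (ℓ : 𝓞 ℚ) ∈ v.asIdeal →
      FrobEqFrobInfty W K (2 ^ 2) ℓ)
    (hinv : ∀ v : HeightOneSpectrum (𝓞 ℚ), Sum.inr v ∈ s ∪ t → Injective (inv (Sum.inr v)))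
    (hsum : inv.SumLocalTermEqZero)
    (B : Finset (galoisCohomology (Wd.torsionGaloisModule ((2 ^ 2 : ℕ) : ℤ)) 1)) (hB : B.card < 2 ^ s.card) :
    ∃ y ∈ kummerOutside Wd (2 ^ 2) (s ∪ t), (2 : ℕ) • y ∉ B ∧
      ∀ l' : Place ℚ, l' ∉ s ∪ t →
        ∀ Z : galoisCohomology (Wd.torsionGaloisModule ((2 ^ 2 : ℕ) : ℤ)) 1,
          (2 : ℕ) • Z ∈ kummerOutside Wd (2 ^ 2) (insert l' (s ∪ t)) →
          (∀ u ∈ s, galoisCohomology.localization (Wd.torsionGaloisModule ((2 ^ 2 : ℕ) : ℤ)) u 1 ((2 : ℕ) • Z) = 0) →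
          (∀ v : HeightOneSpectrum (𝓞 ℚ), Sum.inr v ∈ t →
            ∀ 𝔓 ∈ v.primesAbove, ∀ F c₀ : absoluteGaloisGroup ℚ, IsArithFrobAt (𝓞 ℚ) F 𝔓 →
              IsComplexConjugation (Rat.castHom ℝ) c₀ → (∀ P : geomTorsion Wd ((2 ^ 2 : ℕ) : ℤ), F • P = c₀ • P) →
              ∃ P₁ : geomTorsion Wd ((2 ^ 2 : ℕ) : ℤ), h1Eval Wd _ ((2 : ℕ) • Z) F = F • P₁ - P₁) →
          invWeilPairing Wd (2 ^ 2) e hμ hadd₁ hadd₂ hgal inv l'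
            (galoisCohomology.localization (Wd.torsionGaloisModule ((2 ^ 2 : ℕ) : ℤ)) l' 1 ((2 : ℕ) • Z))
            (galoisCohomology.localization (Wd.torsionGaloisModule ((2 ^ 2 : ℕ) : ℤ)) l' 1 y) = 0 := by
  have hd : ((NumberField.discr K : ℤ) : ℚ) ≠ 0 := by exact_mod_cast NumberField.discr_ne_zero K
  have hΔ' : Wd.Δ < 0 := Δ_neg_of_smul_quadraticTwist_eq W hd Wd hC hΔ
  have hρ2' : Wd.HasSurjectiveModNGaloisRep 2 := by
    rw [← hC]
    exact hasSurjectiveModNGaloisRep_smul _ C 2 ((hasSurjectiveModNGaloisRep_two_quadraticTwist_iff W hd).mpr hρ2)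
  refine exists_auxiliary_bottomRung_not_mem Wd e hμ hadd₁ hadd₂ hgal halt hnondeg inv hΔ' hρ2' (K := K) s t hst (fun u hu ↦ ?_)
    (fun v ℓ hℓ hvt hv ↦ frobEqFrobInfty_of_smul_quadraticTwist_eq W hK Wd hC (ht4 v ℓ hℓ hvt hv)) hinv hsum B hB
  obtain ⟨v, ℓ, hℓp, huv, hℓ2, hv, hℓd, hgood, hFrob, hidx⟩ := hTK u hu
  refine ⟨v, ℓ, hℓp, huv, hℓ2, hv, hasGoodReductionAtPrime_of_smul_quadraticTwist_eq W hK.1 hodd Wd hC hℓd hgood,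
    frobEqFrobInfty_of_smul_quadraticTwist_eq W hK Wd hC hFrob, ?_⟩
  rwa [kolyvaginIndex_eq_of_smul_quadraticTwist_eq W hK.1 hodd Wd hC hℓ2 hℓd hgood 2]

include halt hnondeg in
/-- **The same for THE canonical family** (`inv`-hypotheses discharged). [cite: MilneADT2006, Ch. I, Thm. 4.10] -/
theorem exists_auxiliary_bottomRung_not_mem_twin_canonical {K : Type} [Field K] [NumberField K]
    (hK : IsImaginaryQuadratic K) (hodd : Odd (NumberField.discr K)) (hΔ : W.Δ < 0) (hρ2 : W.HasSurjectiveModNGaloisRep 2)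
    {C : VariableChange ℚ} (hC : C • W.quadraticTwist ((NumberField.discr K : ℤ) : ℚ) = Wd)
    (s t : Finset (Place ℚ)) (hst : Disjoint s t)
    (hTK : ∀ u ∈ s ∪ t, ∃ (v : HeightOneSpectrum (𝓞 ℚ)) (ℓ : ℕ) (_ : Fact ℓ.Prime), u = Sum.inr v ∧ ℓ ≠ 2 ∧ (ℓ : 𝓞 ℚ) ∈ v.asIdeal ∧
      ¬ ((ℓ : ℤ) ∣ NumberField.discr K) ∧ W.HasGoodReductionAtPrime ℓ ∧ FrobEqFrobInfty W K 2 ℓ ∧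
      2 ≤ Zhang2014.kolyvaginIndex W 2 ℓ)
    (ht4 : ∀ (v : HeightOneSpectrum (𝓞 ℚ)) (ℓ : ℕ), ℓ.Prime → Sum.inr v ∈ t → (ℓ : 𝓞 ℚ) ∈ v.asIdeal →
      FrobEqFrobInfty W K (2 ^ 2) ℓ)
    (B : Finset (galoisCohomology (Wd.torsionGaloisModule ((2 ^ 2 : ℕ) : ℤ)) 1)) (hB : B.card < 2 ^ s.card) :
    ∃ y ∈ kummerOutside Wd (2 ^ 2) (s ∪ t), (2 : ℕ) • y ∉ B ∧
      ∀ l' : Place ℚ, l' ∉ s ∪ t →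
        ∀ Z : galoisCohomology (Wd.torsionGaloisModule ((2 ^ 2 : ℕ) : ℤ)) 1,
          (2 : ℕ) • Z ∈ kummerOutside Wd (2 ^ 2) (insert l' (s ∪ t)) →
          (∀ u ∈ s, galoisCohomology.localization (Wd.torsionGaloisModule ((2 ^ 2 : ℕ) : ℤ)) u 1 ((2 : ℕ) • Z) = 0) →
          (∀ v : HeightOneSpectrum (𝓞 ℚ), Sum.inr v ∈ t →
            ∀ 𝔓 ∈ v.primesAbove, ∀ F c₀ : absoluteGaloisGroup ℚ, IsArithFrobAt (𝓞 ℚ) F 𝔓 →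
              IsComplexConjugation (Rat.castHom ℝ) c₀ → (∀ P : geomTorsion Wd ((2 ^ 2 : ℕ) : ℤ), F • P = c₀ • P) →
              ∃ P₁ : geomTorsion Wd ((2 ^ 2 : ℕ) : ℤ), h1Eval Wd _ ((2 : ℕ) • Z) F = F • P₁ - P₁) →
          invWeilPairing Wd (2 ^ 2) e hμ hadd₁ hadd₂ hgal (LocalInvariants.canonical ℚ (2 ^ 2)) l'
            (galoisCohomology.localization (Wd.torsionGaloisModule ((2 ^ 2 : ℕ) : ℤ)) l' 1 ((2 : ℕ) • Z))
            (galoisCohomology.localization (Wd.torsionGaloisModule ((2 ^ 2 : ℕ) : ℤ)) l' 1 y) = 0 := by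
  haveI : NeZero (2 ^ 2) := ⟨by norm_num⟩
  exact exists_auxiliary_bottomRung_not_mem_twin W Wd e hμ hadd₁ hadd₂ hgal halt hnondeg (LocalInvariants.canonical ℚ (2 ^ 2)) hK hodd
    hΔ hρ2 hC s t hst hTK ht4 (fun v _ ↦ ((LocalInvariants.canonical_isPerfect (K := ℚ) (n := 2 ^ 2)) v).1.1)
    (Summit.BirchSwinnertonDyer.BirchSwinnertonDyer.Theorems.SchneiderFreeAdditiveX3.PoitouTateReduction.sumLocalTermEqZero_canonical
      (K := ℚ) (2 ^ 2)) B hB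

end Twin

end Summit.BirchSwinnertonDyer.BirchSwinnertonDyer.Theorems.GenusExact.DeepOwnPrime

end
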